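/-
Copyright (c) 2026. All rights reserved.
Released under Apache 2.0 license as described in the file LICENSE.
Authors: abc-iut cell — seat abc-iut-w4-d104 (gen 2): proof-only BRIDGE between the germ MODEL of
[AbsTopIII] Prop 2.6 (`HolomorphicCoresLocalLinearProofs`, this seat's gen 0) and the abstract
orientations of Prop 2.5 (d) (`ParallelogramsPlanarOrientationSign`, over abc-iut-L6-t15's chain).
-/
import Literature.AnabelianGeometry.AbsoluteAnabelian.ParallelogramsPlanarOrientationSign
import Literature.AnabelianGeometry.AbsoluteAnabelian.HolomorphicCoresLocalLinearProofs
import HarnessLib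

/-!
# [AbsTopIII] Prop 2.6 (a): the germ model's "preserves the orientations" IS preservation of the
# abstract orientations of Prop 2.5 (d)

S. Mochizuki, *Topics in absolute anabelian geometry III*, Prop. 2.6 (a) (kurims p.57; bib key
`MochizukiAbsTopIII2015`):

> (a) … `𝒜_p` for the group of automorphisms of the projective system of connected open
> neighborhoods of `p` in `U` that are compatible with the "local additive structures" of
> Proposition 2.5, (e), and preserve the orthogonal frames and orientations [at `p`] of
> Proposition 2.5, (d) …

This PROOF-ONLY file (no definitions) closes the `TODO(bridge)` left in the germ model
`HolomorphicCoresLocalLinearProofs.lean` (abc-iut-w4-d104 gen 0, p412533) for the ORIENTATION condition: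
there `LocGerm.PreservesOrientation F` is typed CONCRETELY ("`F` is an affine germ `z ↦ p + L (z − p)`
with `0 < det L`"), whereas print refers to the ABSTRACT orientations `Parallelograms.Orientations 𝒬 p`
of Prop. 2.5 (d) (`HolomorphicCores.lean`, abc-iut-L4-t14; classified by determinant sign in
`ParallelogramsPlanarOrientationSign.lean`).  For an open `U ⊆ ℂ`, any `𝒮(U) ⊆ 𝒬 ⊆ 𝒫(U)`, `p ∈ U`:

* `image_affine_openParallelogram` / `image_affine_segment` / `det_pair_apply`: the canonical affine
  representative `z ↦ p + L (z − p)` of `linGerm p L` carries a frame with corner vectors `(e₁, e₂)`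
  onto a frame with corner vectors `(L e₁, L e₂)`, of determinant `det L · det(e₁, e₂)`;
* `LocGerm.orientation_map_eq_of_det_pos` / `orientation_map_ne_of_det_neg`: `det L > 0` keeps every
  frame at `p` in ITS OWN orientation class, `det L < 0` moves every frame to THE OTHER class;
* `LocGerm.preservesOrientation_iff_orientations` — **the bridge**: `(linGerm p L).PreservesOrientation`
  IFF `det L ≠ 0` (frames go to frames) and every frame at `p` lies in the same class of
  `Parallelograms.Orientations 𝒬 p` as its image frame — print's "preserve the … orientations [at `p`]
  of Proposition 2.5, (d)"; hence `germAut_preserves_orientations` for every element of `𝒜_p`.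

Refereed pre-IUT material ([AbsTopIII] §2); nothing here bears on the disputed [IUTchIII] Cor. 3.12;
typed ≠ endorsed.  The orthogonal-frame condition (Rmk. 2.5.1, rectangles `ℛ(U)`) is bridged separately.
-/

namespace Literature.AnabelianGeometry.AbsoluteAnabelian

open _root_.Complex _root_.Set _root_.Topology _root_.Filter _root_.Metric

noncomputable section

/-! ### The canonical affine representative of a germ acts on frames -/

/-- The determinant of a continuous `ℝ`-linear `L : ℂ → ℂ` multiplies the determinant of a pair of
vectors: `det(L e₁, L e₂) = det L · det(e₁, e₂)`. (Auxiliary.)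
[cite: MochizukiAbsTopIII2015, Proposition 2.6 (a) p.57] -/
theorem det_pair_apply (L : ℂ →L[ℝ] ℂ) (e₁ e₂ : ℂ) :
    (L e₁).re * (L e₂).im - (L e₁).im * (L e₂).re =
      LinearMap.det (L : ℂ →ₗ[ℝ] ℂ) * (e₁.re * e₂.im - e₁.im * e₂.re) := by
  rw [det_eq_of_clm, clm_apply_eq L e₁, clm_apply_eq L e₂]
  simp only [Complex.add_re, Complex.add_im, Complex.smul_re, Complex.smul_im, smul_eq_mul]
  ring

/-- A linear map of non-zero determinant carries independent pairs to independent pairs (frames to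
frames). (Auxiliary.) [cite: MochizukiAbsTopIII2015, Proposition 2.6 (a) p.57] -/
theorem linearIndependent_pair_apply {L : ℂ →L[ℝ] ℂ} (hL : LinearMap.det (L : ℂ →ₗ[ℝ] ℂ) ≠ 0)
    {e₁ e₂ : ℂ} (he : LinearIndependent ℝ ![e₁, e₂]) : LinearIndependent ℝ ![L e₁, L e₂] := by
  rw [linearIndependent_pair_iff_det] at he ⊢
  rw [det_pair_apply]
  exact mul_ne_zero hL he

/-- The canonical representative `z ↦ p + L (z − p)` of the affine germ `linGerm p L` maps the open
parallelogram with corner `p` and edge vectors `(e₁, e₂)` onto the one with edge vectors `(L e₁, L e₂)`.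
[cite: MochizukiAbsTopIII2015, Proposition 2.6 (a) p.57] -/
theorem image_affine_openParallelogram (p : ℂ) (L : ℂ →L[ℝ] ℂ) (e₁ e₂ : ℂ) :
    (fun z => p + L (z - p)) '' openParallelogram p e₁ e₂ = openParallelogram p (L e₁) (L e₂) := by
  have hL : ∀ (s t : ℝ), L ((s : ℂ) * e₁ + (t : ℂ) * e₂) = (s : ℂ) * L e₁ + (t : ℂ) * L e₂ := by
    intro s t
    rw [map_add, ← Complex.real_smul, ← Complex.real_smul, map_smul, map_smul, Complex.real_smul,
      Complex.real_smul]
  ext x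
  simp only [openParallelogram, mem_image, mem_setOf_eq]
  constructor
  · rintro ⟨z, ⟨s, t, hs, hs1, ht, ht1, rfl⟩, rfl⟩
    refine ⟨s, t, hs, hs1, ht, ht1, ?_⟩
    rw [show p + (s : ℂ) * e₁ + (t : ℂ) * e₂ - p = (s : ℂ) * e₁ + (t : ℂ) * e₂ by ring, hL]
    ring
  · rintro ⟨s, t, hs, hs1, ht, ht1, rfl⟩
    refine ⟨p + (s : ℂ) * e₁ + (t : ℂ) * e₂, ⟨s, t, hs, hs1, ht, ht1, rfl⟩, ?_⟩
    rw [show p + (s : ℂ) * e₁ + (t : ℂ) * e₂ - p = (s : ℂ) * e₁ + (t : ℂ) * e₂ by ring, hL]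
    ring

/-- The canonical affine representative maps the side `[p, p + e]` onto the side `[p, p + L e]`.
[cite: MochizukiAbsTopIII2015, Proposition 2.6 (a) p.57] -/
theorem image_affine_segment (p : ℂ) (L : ℂ →L[ℝ] ℂ) (e : ℂ) :
    (fun z => p + L (z - p)) '' segment ℝ p (p + e) = segment ℝ p (p + L e) := by
  rw [segment_eq_image', segment_eq_image', image_image]
  simp only [add_sub_cancel_left]
  refine image_congr fun θ _ => ?_
  simp only [map_smul]

/-! ### Prop 2.6 (a): the germ model's orientation condition against the abstract orientations -/

section Bridge

variable {U : Set ℂ} (hU : IsOpen U) {𝒬 : Set (Set U)}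
  (h𝒬 : ∀ Q ∈ 𝒬, Subtype.val '' Q ∈ parallelogramsIn U)
  (h𝒮 : ∀ Q : Set U, Subtype.val '' Q ∈ squaresIn U → Q ∈ 𝒬)

/-- The model's concrete orientation condition on an affine germ is positivity of the determinant of
its (unique) linear part. [cite: MochizukiAbsTopIII2015, Proposition 2.6 (a) p.57] -/
theorem LocGerm.preservesOrientation_linGerm_iff (p : ℂ) (L : ℂ →L[ℝ] ℂ) :
    (LocGerm.linGerm p L).PreservesOrientation ↔ 0 < LinearMap.det (L : ℂ →ₗ[ℝ] ℂ) := by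
  constructor
  · rintro ⟨L', hL', hdet⟩
    obtain rfl := LocGerm.linGerm_injective p hL'
    exact hdet
  · exact fun h => ⟨L, rfl, h⟩

include hU h𝒬 h𝒮 in
/-- **Prop 2.6 (a), orientation-preserving germs**: if `det L > 0`, a frame at `p` with corner vectors
`(e₁, e₂)` and its image frame under the canonical representative of `linGerm p L` (corner vectors
`(L e₁, L e₂)`, cf. `image_affine_openParallelogram`, `image_affine_segment`) lie in the SAME class of
`Orientations 𝒬 p`. [cite: MochizukiAbsTopIII2015, Proposition 2.6 (a) p.57] -/
theorem LocGerm.orientation_map_eq_of_det_pos {p : U} {L : ℂ →L[ℝ] ℂ}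
    (hL : 0 < LinearMap.det (L : ℂ →ₗ[ℝ] ℂ))
    {F F' : {PF : Set U × (Set U × Set U) // Parallelograms.IsFrameOf 𝒬 p PF.1 PF.2}} {e₁ e₂ : ℂ}
    (he : LinearIndependent ℝ ![e₁, e₂])
    (hP : Subtype.val '' F.1.1 = openParallelogram (p : ℂ) e₁ e₂)
    (h₁ : Subtype.val '' F.1.2.1 = segment ℝ (p : ℂ) (p + e₁))
    (h₂ : Subtype.val '' F.1.2.2 = segment ℝ (p : ℂ) (p + e₂))
    (hP' : Subtype.val '' F'.1.1 = openParallelogram (p : ℂ) (L e₁) (L e₂))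
    (h₁' : Subtype.val '' F'.1.2.1 = segment ℝ (p : ℂ) (p + L e₁))
    (h₂' : Subtype.val '' F'.1.2.2 = segment ℝ (p : ℂ) (p + L e₂)) :
    (Quot.mk _ F : Parallelograms.Orientations 𝒬 p) = Quot.mk _ F' := by
  refine Parallelograms.orientation_eq_of_det_pos_iff hU h𝒬 h𝒮 he
    (linearIndependent_pair_apply hL.ne' he) hP h₁ h₂ hP' h₁' h₂' ?_
  rw [det_pair_apply]
  constructor
  · intro h; exact mul_pos hL h
  · intro h; exact pos_of_mul_pos_right h hL.le

include hU h𝒬 h𝒮 in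
/-- **Prop 2.6 (a), orientation-reversing germs**: if `det L < 0`, a frame at `p` and its image frame
under the canonical representative of `linGerm p L` lie in DIFFERENT classes of `Orientations 𝒬 p`.
[cite: MochizukiAbsTopIII2015, Proposition 2.6 (a) p.57] -/
theorem LocGerm.orientation_map_ne_of_det_neg {p : U} {L : ℂ →L[ℝ] ℂ}
    (hL : LinearMap.det (L : ℂ →ₗ[ℝ] ℂ) < 0)
    {F F' : {PF : Set U × (Set U × Set U) // Parallelograms.IsFrameOf 𝒬 p PF.1 PF.2}} {e₁ e₂ : ℂ}
    (he : LinearIndependent ℝ ![e₁, e₂])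
    (hP : Subtype.val '' F.1.1 = openParallelogram (p : ℂ) e₁ e₂)
    (h₁ : Subtype.val '' F.1.2.1 = segment ℝ (p : ℂ) (p + e₁))
    (h₂ : Subtype.val '' F.1.2.2 = segment ℝ (p : ℂ) (p + e₂))
    (hP' : Subtype.val '' F'.1.1 = openParallelogram (p : ℂ) (L e₁) (L e₂))
    (h₁' : Subtype.val '' F'.1.2.1 = segment ℝ (p : ℂ) (p + L e₁))
    (h₂' : Subtype.val '' F'.1.2.2 = segment ℝ (p : ℂ) (p + L e₂)) :
    (Quot.mk _ F : Parallelograms.Orientations 𝒬 p) ≠ Quot.mk _ F' := by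
  intro h
  have hiff := Parallelograms.det_pos_iff_of_orientation_eq hU h𝒬 h𝒮 h he
    (linearIndependent_pair_apply hL.ne he) hP h₁ h₂ hP' h₁' h₂'
  rw [det_pair_apply] at hiff
  have hd : e₁.re * e₂.im - e₁.im * e₂.re ≠ 0 := (linearIndependent_pair_iff_det _ _).1 he
  rcases lt_or_gt_of_ne hd with hneg | hpos
  · exact absurd (hiff.2 (mul_pos_of_neg_of_neg hL hneg)) (not_lt.2 hneg.le)
  · exact absurd (hiff.1 hpos) (not_lt.2 (mul_neg_of_neg_of_pos hL hpos).le)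

include hU in
/-- Small square frames at `p` whose images under a given linear `L` also have closure in `U` exist.
(Auxiliary.) [cite: MochizukiAbsTopIII2015, Proposition 2.6 (a) p.57] -/
theorem exists_small_square_frame_image (p : U) (L : ℂ →L[ℝ] ℂ) :
    ∃ e₁ e₂ : ℂ, LinearIndependent ℝ ![e₁, e₂] ∧ 0 < e₁.re * e₂.im - e₁.im * e₂.re ∧
      closure (openParallelogram (p : ℂ) e₁ e₂) ⊆ U ∧
      closure (openParallelogram (p : ℂ) (L e₁) (L e₂)) ⊆ U := by
  obtain ⟨r, hr, hball⟩ := Metric.isOpen_iff.1 hU p p.2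
  obtain ⟨C, hC0, hC⟩ : ∃ C : ℝ, 0 < C ∧ ∀ z : ℂ, ‖L z‖ ≤ C * ‖z‖ := L.bound
  set ε : ℝ := min (r / 4) (r / (4 * C)) with hε
  have hεpos : 0 < ε := lt_min (by positivity) (by positivity)
  have hε1 : ε ≤ r / 4 := min_le_left _ _
  have hε2 : C * ε ≤ r / 4 := by
    have : ε ≤ r / (4 * C) := min_le_right _ _
    calc C * ε ≤ C * (r / (4 * C)) := by gcongr
      _ = r / 4 := by field_simp
  have hli : LinearIndependent ℝ ![((ε : ℝ) : ℂ), ((ε : ℝ) : ℂ) * I] := by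
    have := linearIndependent_pair_mul_I (v := ((ε : ℝ) : ℂ)) (by exact_mod_cast hεpos.ne')
    simpa [mul_comm] using this
  have hn1 : ‖((ε : ℝ) : ℂ)‖ = ε := by rw [Complex.norm_real, Real.norm_of_nonneg hεpos.le]
  have hn2 : ‖((ε : ℝ) : ℂ) * I‖ = ε := by rw [norm_mul, Complex.norm_I, mul_one, hn1]
  have hsub : ∀ a b : ℂ, ‖a‖ + ‖b‖ < r → closure (openParallelogram (p : ℂ) a b) ⊆ U :=
    fun a b hab => (closure_openParallelogram_subset_closedBall (p : ℂ) a b).trans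
      ((Metric.closedBall_subset_ball hab).trans hball)
  refine ⟨(ε : ℂ), (ε : ℂ) * I, hli, ?_, hsub _ _ ?_, hsub _ _ ?_⟩
  · simp only [Complex.ofReal_re, Complex.mul_im, Complex.ofReal_im, Complex.I_re, Complex.I_im,
      Complex.mul_re]
    nlinarith
  · rw [hn1, hn2]; linarith
  · calc ‖L (ε : ℂ)‖ + ‖L ((ε : ℂ) * I)‖ ≤ C * ‖((ε : ℝ) : ℂ)‖ + C * ‖((ε : ℝ) : ℂ) * I‖ :=
          add_le_add (hC _) (hC _)
      _ = C * ε + C * ε := by rw [hn1, hn2]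
      _ < r := by linarith

include hU h𝒬 h𝒮 in
/-- **The bridge ([AbsTopIII] Prop 2.6 (a), "preserve the … orientations [at `p`] of Proposition 2.5,
(d)")**: for `p ∈ U` and an affine germ `linGerm p L` at `p`, the germ MODEL's concrete condition
`PreservesOrientation` (positive determinant of the linear part) holds IFF the germ maps frames to frames
(`det L ≠ 0`) and every frame at `p` with corner vectors `(e₁, e₂)` lies in the SAME class of the
abstract `Parallelograms.Orientations 𝒬 p` of Prop. 2.5 (d) as every frame at `p` with corner vectors
`(L e₁, L e₂)` — its image under the canonical representative `z ↦ p + L (z − p)`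
(`image_affine_openParallelogram`, `image_affine_segment`) — for any `𝒮(U) ⊆ 𝒬 ⊆ 𝒫(U)`.
[cite: MochizukiAbsTopIII2015, Proposition 2.6 (a) p.57] -/
theorem LocGerm.preservesOrientation_iff_orientations (p : U) (L : ℂ →L[ℝ] ℂ) :
    (LocGerm.linGerm (p : ℂ) L).PreservesOrientation ↔
      LinearMap.det (L : ℂ →ₗ[ℝ] ℂ) ≠ 0 ∧
        ∀ (F F' : {PF : Set U × (Set U × Set U) // Parallelograms.IsFrameOf 𝒬 p PF.1 PF.2})
          (e₁ e₂ : ℂ), LinearIndependent ℝ ![e₁, e₂] →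
          Subtype.val '' F.1.1 = openParallelogram (p : ℂ) e₁ e₂ →
          Subtype.val '' F.1.2.1 = segment ℝ (p : ℂ) (p + e₁) →
          Subtype.val '' F.1.2.2 = segment ℝ (p : ℂ) (p + e₂) →
          Subtype.val '' F'.1.1 = openParallelogram (p : ℂ) (L e₁) (L e₂) →
          Subtype.val '' F'.1.2.1 = segment ℝ (p : ℂ) (p + L e₁) →
          Subtype.val '' F'.1.2.2 = segment ℝ (p : ℂ) (p + L e₂) →
          (Quot.mk _ F : Parallelograms.Orientations 𝒬 p) = Quot.mk _ F' := by
  rw [LocGerm.preservesOrientation_linGerm_iff]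
  constructor
  · intro hL
    exact ⟨hL.ne', fun F F' e₁ e₂ he hP h₁ h₂ hP' h₁' h₂' =>
      LocGerm.orientation_map_eq_of_det_pos hU h𝒬 h𝒮 hL he hP h₁ h₂ hP' h₁' h₂'⟩
  · rintro ⟨hdet, hall⟩
    rcases lt_or_gt_of_ne hdet with hneg | hpos
    · obtain ⟨e₁, e₂, he, -, hce, hcLe⟩ := exists_small_square_frame_image hU p L
      have hLe := linearIndependent_pair_apply hdet he
      obtain ⟨hPe, hS₁e, hS₂e⟩ := subsets_of_closure_openParallelogram_subset he hce
      obtain ⟨hPLe, hS₁Le, hS₂Le⟩ := subsets_of_closure_openParallelogram_subset hLe hcLe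
      have h := hall
        ⟨(Subtype.val ⁻¹' openParallelogram (p : ℂ) e₁ e₂,
          (Subtype.val ⁻¹' segment ℝ (p : ℂ) (p + e₁), Subtype.val ⁻¹' segment ℝ (p : ℂ) (p + e₂))),
          Parallelograms.isFrameOf_of_vectors hU h𝒬 h𝒮 he hce⟩
        ⟨(Subtype.val ⁻¹' openParallelogram (p : ℂ) (L e₁) (L e₂),
          (Subtype.val ⁻¹' segment ℝ (p : ℂ) (p + L e₁),
            Subtype.val ⁻¹' segment ℝ (p : ℂ) (p + L e₂))),
          Parallelograms.isFrameOf_of_vectors hU h𝒬 h𝒮 hLe hcLe⟩ e₁ e₂ he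
        (image_val_preimage_val_of_subset hPe) (image_val_preimage_val_of_subset hS₁e)
        (image_val_preimage_val_of_subset hS₂e) (image_val_preimage_val_of_subset hPLe)
        (image_val_preimage_val_of_subset hS₁Le) (image_val_preimage_val_of_subset hS₂Le)
      exact absurd h (LocGerm.orientation_map_ne_of_det_neg hU h𝒬 h𝒮 hneg he
        (image_val_preimage_val_of_subset hPe) (image_val_preimage_val_of_subset hS₁e)
        (image_val_preimage_val_of_subset hS₂e) (image_val_preimage_val_of_subset hPLe)
        (image_val_preimage_val_of_subset hS₁Le) (image_val_preimage_val_of_subset hS₂Le))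
    · exact hpos

include hU h𝒬 h𝒮 in
/-- **Prop 2.6 (a): every element of `𝒜_p = germAut p` preserves the abstract orientations at `p`** —
it is an affine germ `linGerm p L` with `det L ≠ 0` whose canonical representative maps each frame at `p`
into its own class of `Orientations 𝒬 p`. [cite: MochizukiAbsTopIII2015, Proposition 2.6 (a) p.57] -/
theorem germAut_preserves_orientations (p : U) (u : (LocGerm (p : ℂ))ˣ) (hu : u ∈ germAut (p : ℂ)) :
    ∃ L : ℂ →L[ℝ] ℂ, (u : LocGerm (p : ℂ)) = LocGerm.linGerm (p : ℂ) L ∧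
      LinearMap.det (L : ℂ →ₗ[ℝ] ℂ) ≠ 0 ∧
      ∀ (F F' : {PF : Set U × (Set U × Set U) // Parallelograms.IsFrameOf 𝒬 p PF.1 PF.2})
        (e₁ e₂ : ℂ), LinearIndependent ℝ ![e₁, e₂] →
        Subtype.val '' F.1.1 = openParallelogram (p : ℂ) e₁ e₂ →
        Subtype.val '' F.1.2.1 = segment ℝ (p : ℂ) (p + e₁) →
        Subtype.val '' F.1.2.2 = segment ℝ (p : ℂ) (p + e₂) →
        Subtype.val '' F'.1.1 = openParallelogram (p : ℂ) (L e₁) (L e₂) →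
        Subtype.val '' F'.1.2.1 = segment ℝ (p : ℂ) (p + L e₁) →
        Subtype.val '' F'.1.2.2 = segment ℝ (p : ℂ) (p + L e₂) →
        (Quot.mk _ F : Parallelograms.Orientations 𝒬 p) = Quot.mk _ F' := by
  obtain ⟨-, -, L, hL, hdet⟩ := (mem_germAut u).1 hu
  have h := (LocGerm.preservesOrientation_iff_orientations hU h𝒬 h𝒮 p L).1 ⟨L, rfl, hdet⟩
  exact ⟨L, hL, h.1, h.2⟩

end Bridge

end

end Literature.AnabelianGeometry.AbsoluteAnabelian
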